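import Literature.NumberTheory.GaloisCohomology.Howard2004.SelmerTriples
import Literature.NumberTheory.GaloisRepresentations.ContinuousCohomologyConnecting
import HarnessLib

/-!
# Howard 2004, Lemma 1.6.2 — the `τ`-eigenspace step: a `τ`-eigencocycle does not vanish at some
# `σ^τ σ`

Topic `NumberTheory/GaloisCohomology/Howard2004` (input of Howard's Lemma 1.6.4, the residual Galois
input of the print leaf G87 `Howard2004.thm161_dvrKolyvaginBound` = Thm. 1.6.1; cell
`pub/bsd-print-x9`, seat `bsd-line-x10b-p1-w2` g15).  THEOREMS ONLY: no definition, no named fact,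
no instance, no notation, no `sorry`.  Companion file `TauEigencocycleFrobeniusProofs.lean` joins
this step with the Čebotarev step (`ChebotarevInertPrimesProofs.lean`, seat w6 g8) and supplies the
entries from classes and a standard subgroup `Λ`.

Printed source.  B. Howard, *The Heegner point Kolyvagin system*, Compositio Math. **140** (2004)
= arXiv:1202.6340, Lemma 1.6.2 (arXiv Lemma 2.6.2, p. 11 L30–58): «Suppose we are given elements
`c⁺ ∈ H¹(K, T̄)⁺`, `c⁻ ∈ H¹(K, T̄)⁻`.  There are infinitely many primes `λ ∈ 𝓛^{(2k-1)}` such that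
`c^± ≠ 0 ⟹ loc_λ(c^±) ≠ 0`.»  Proof (p. 11 L36–47): restriction to `G_L` is injective (H.2),
`c^±` become `Gal(L/K)`-equivariant homomorphisms `G = Gal(E/L) → T̄`; «We claim that the maps
`c⁺ : G⁺ → T̄⁺`, `c⁻ : G⁺ → T̄⁻` are nontrivial.  Indeed, if `c⁺(G⁺) = 0` then
`c⁺(G) = c⁺(G⁻) ⊂ T̄⁻`, and so `R · c⁺(G)` is an `R[G_K]`-submodule of `T̄` contained in `T̄⁻`.  This
contradicts Hypotheses H.1 and H.5(a).  Similar considerations apply to `c⁻`.  The kernels of the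
maps have codimension `≥ 1`, and so there is an `η ∈ G⁺` for which `c^±(η)` are both nonzero, and we
may choose some `σ ∈ G` such that `η = (τσ)²`.»

What is here, MODULE-LEVEL and for the ABSTRACT `ConjugationDatum` / `ResidualTau` of
`Howard2004/SelmerTriples.lean` (`g^τ = cd.conj g`, `θ = A.θ` the action of `τ` on `T̄`).  Howard's
finite group `G = Gal(E/L)` is replaced by a normal `τ`-stable subgroup `Λ ≤ Γ_K` acting trivially on
`T̄` (his `Γ_L`), on which continuous 1-cocycles are homomorphisms; `G⁺ ∋ σ^τ σ`; a class
`c ∈ H¹(K, T̄)^±` is read on `Λ` as the pointwise identity `φ(g^τ) = ±θ(φ(g))` of a representing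
cocycle `φ` (the companion file produces such representatives), and «`c ≠ 0`» as «`φ|_Λ ≠ 0`»
(companion file, from the injectivity of restriction which H.2 supplies).

* §1 cocycle algebra on a subgroup acting trivially (`φ(gh) = φ(g) + φ(h)`, `φ(xgx⁻¹) = x·φ(g)`,
  additivity and continuity of `σ ↦ φ(σ^τ σ)`).
* §2 **`ResidualTau.exists_mem_apply_conj_mul_self_ne_zero`** — ONE eigencocycle `φ` with
  `φ(g^τ) = L(φ g)` on `Λ` (`L = θ` or `L = -θ`), `φ|_Λ ≠ 0` ⇒ `∃ σ ∈ Λ, φ(σ^τ σ) ≠ 0`, under the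
  irreducibility clause of H.1, a vector `v ≠ 0` with `L v = v` (H.5(a): `x⁺` for `θ`, `x⁻` for `-θ`)
  and `2 ∈ R×`; corollaries `…_of_theta_eq` / `…_of_theta_eq_neg`.  This is «`c^± : G⁺ → T̄^±` is
  nontrivial».
* §3 **`ResidualTau.exists_isOpen_forall_apply_conj_mul_ne_zero`** — TWO eigencocycles `φ⁺`, `φ⁻`,
  `Λ` open: `∃ σ ∈ Λ` and an OPEN subgroup `U ≤ Λ` with `φ^±((uσ)^τ (uσ)) ≠ 0` for every `u ∈ U`
  («there is `η = (τσ)² ∈ G⁺` with `c^±(η)` both nonzero», the open `U` being the common kernel —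
  the shape the Čebotarev step consumes); single-cocycle version
  `…_forall_apply_conj_mul_ne_zero_single`.

HONEST FRAMING.  This is the eigenspace step of Lemma 1.6.2 only; the Čebotarev junction is in the
companion file; the local criterion, Lemma 1.6.4 and Thm. 1.6.1 are NOT here;
`thm161_dvrKolyvaginBound` is NOT proved; no summit statement is proved; the Birch–Swinnerton-Dyer
conjecture is not proved by any of this.

References: [Howard2004HeegnerKolyvagin] Lemma 1.6.2 (arXiv 2.6.2, p. 11 L30–58) and §1.3 H.1,
H.2, H.5(a) (arXiv p. 7); [McCallumLMS1991] §3 Prop. 3.1 (proof); [GrossLMS1991] §9 (proof of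
Prop. 9.5: the same eigenspace argument for `E[p]`).
-/

set_option autoImplicit false

noncomputable section

open scoped Classical Pointwise
open Function NumberField IsDedekindDomain Field

namespace Literature.NumberTheory.GaloisCohomology.Howard2004

open Literature.NumberTheory.GaloisRepresentations
open Literature.NumberTheory.EllipticCurves

variable {K : Type} [Field K] [NumberField K] {Nbar : Type} [AddCommGroup Nbar]
  [TopologicalSpace Nbar] [DiscreteTopology Nbar]

/-! ## §1 Continuous 1-cocycles on a subgroup acting trivially -/

section Trivial

variable (ρbar : DiscreteGaloisModule K Nbar)

omit [NumberField K] in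
/-- On an element `g` acting trivially, a crossed homomorphism is additive: `φ(gh) = φ(g) + φ(h)`.
[cite: Howard2004HeegnerKolyvagin, Lemma 1.6.2 proof (arXiv p. 11 L38–39: «`H¹(L, T̄)^{Gal(L/K)} ≅ Hom(G_L, T̄)^{Gal(L/K)}`»)] -/
theorem contOneCocycles.apply_mul_of_apply_eq (φ : contOneCocycles ρbar.toTopRep)
    {g : absoluteGaloisGroup K} (hg : ∀ x : Nbar, ρbar g x = x) (h : absoluteGaloisGroup K) :
    φ.1 (g * h) = φ.1 g + φ.1 h := by
  rw [(mem_contOneCocycles_iff φ.1).mp φ.2 g h, ContinuousRep.toTopRep_ρ_apply, hg]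

omit [NumberField K] in
/-- On an element `g` acting trivially, `φ(g⁻¹) = -φ(g)`.
[cite: Howard2004HeegnerKolyvagin, Lemma 1.6.2 proof (arXiv p. 11 L38–39)] -/
theorem contOneCocycles.apply_inv_of_apply_eq (φ : contOneCocycles ρbar.toTopRep)
    {g : absoluteGaloisGroup K} (hg : ∀ x : Nbar, ρbar g x = x) : φ.1 g⁻¹ = -φ.1 g := by
  have h := contOneCocycles.apply_mul_of_apply_eq ρbar φ hg g⁻¹
  rw [mul_inv_cancel, contOneCocycles.apply_one] at h
  exact (neg_eq_of_add_eq_zero_right h.symm).symm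

omit [NumberField K] in
/-- **Equivariance of the restricted homomorphism**: for `g` acting trivially on `T̄` and any
`x ∈ Γ_K`, `φ(x g x⁻¹) = x · φ(g)` — the restriction of a class to a normal subgroup acting
trivially lands in the `Γ_K`-equivariant homomorphisms.
[cite: Howard2004HeegnerKolyvagin, Lemma 1.6.2 proof (arXiv p. 11 L38–39)] -/
theorem contOneCocycles.apply_conj_of_apply_eq (φ : contOneCocycles ρbar.toTopRep)
    {g : absoluteGaloisGroup K} (hg : ∀ x : Nbar, ρbar g x = x) (x : absoluteGaloisGroup K) :
    φ.1 (x * g * x⁻¹) = ρbar x (φ.1 g) := by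
  have h1 : φ.1 (x * g * x⁻¹) = φ.1 (x * g) + ρbar (x * g) (φ.1 x⁻¹) :=
    (mem_contOneCocycles_iff φ.1).mp φ.2 _ _
  have h2 : φ.1 (x * g) = φ.1 x + ρbar x (φ.1 g) := (mem_contOneCocycles_iff φ.1).mp φ.2 _ _
  have h3 : φ.1 (x * x⁻¹) = φ.1 x + ρbar x (φ.1 x⁻¹) := (mem_contOneCocycles_iff φ.1).mp φ.2 _ _
  rw [mul_inv_cancel, contOneCocycles.apply_one] at h3
  rw [h1, h2, map_mul, Module.End.mul_apply, hg, add_assoc, add_left_comm, ← h3, add_zero]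

/-- The symmetric product `σ ↦ φ(σ^τ σ)` is additive on a `τ`-stable subgroup acting trivially:
`φ((gh)^τ (gh)) = φ(g^τ g) + φ(h^τ h)` (all four factors act trivially; `T̄` is abelian).
[cite: Howard2004HeegnerKolyvagin, Lemma 1.6.2 proof (arXiv p. 11 L45–47: «we may choose some `σ ∈ G` such that `η = (τσ)²`»)] -/
theorem contOneCocycles.apply_conj_mul_self_mul (cd : ConjugationDatum K)
    (φ : contOneCocycles ρbar.toTopRep) {Λ : Subgroup (absoluteGaloisGroup K)}
    (hΛc : ∀ g ∈ Λ, cd.conj g ∈ Λ) (hΛt : ∀ g ∈ Λ, ∀ x : Nbar, ρbar g x = x)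
    {g h : absoluteGaloisGroup K} (hg : g ∈ Λ) (hh : h ∈ Λ) :
    φ.1 (cd.conj (g * h) * (g * h)) = φ.1 (cd.conj g * g) + φ.1 (cd.conj h * h) := by
  rw [show cd.conj (g * h) = cd.conj g * cd.conj h from map_mul cd.conj g h, mul_assoc,
    contOneCocycles.apply_mul_of_apply_eq ρbar φ (hΛt _ (hΛc g hg)) (cd.conj h * (g * h)),
    contOneCocycles.apply_mul_of_apply_eq ρbar φ (hΛt _ (hΛc h hh)) (g * h),
    contOneCocycles.apply_mul_of_apply_eq ρbar φ (hΛt _ hg) h,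
    contOneCocycles.apply_mul_of_apply_eq ρbar φ (hΛt _ (hΛc g hg)) g,
    contOneCocycles.apply_mul_of_apply_eq ρbar φ (hΛt _ (hΛc h hh)) h]
  abel

/-- `φ(1^τ · 1) = 0`. [cite: Howard2004HeegnerKolyvagin, Lemma 1.6.2 proof (arXiv p. 11 L45–47)] -/
theorem contOneCocycles.apply_conj_one_mul_one (cd : ConjugationDatum K)
    (φ : contOneCocycles ρbar.toTopRep) : φ.1 (cd.conj 1 * 1) = 0 := by
  rw [map_one, mul_one, contOneCocycles.apply_one]

/-- `φ((g⁻¹)^τ g⁻¹) = -φ(g^τ g)` on a `τ`-stable subgroup acting trivially.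
[cite: Howard2004HeegnerKolyvagin, Lemma 1.6.2 proof (arXiv p. 11 L45–47)] -/
theorem contOneCocycles.apply_conj_inv_mul_inv (cd : ConjugationDatum K)
    (φ : contOneCocycles ρbar.toTopRep) {Λ : Subgroup (absoluteGaloisGroup K)}
    (hΛc : ∀ g ∈ Λ, cd.conj g ∈ Λ) (hΛt : ∀ g ∈ Λ, ∀ x : Nbar, ρbar g x = x)
    {g : absoluteGaloisGroup K} (hg : g ∈ Λ) :
    φ.1 (cd.conj g⁻¹ * g⁻¹) = -φ.1 (cd.conj g * g) := by
  have h := contOneCocycles.apply_conj_mul_self_mul ρbar cd φ hΛc hΛt (Λ.inv_mem hg) hg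
  rw [inv_mul_cancel, contOneCocycles.apply_conj_one_mul_one] at h
  exact eq_neg_of_add_eq_zero_left h.symm

/-- The map `σ ↦ φ(σ^τ σ)` is continuous (into the discrete `T̄`).
[cite: Howard2004HeegnerKolyvagin, Lemma 1.6.2 proof (arXiv p. 11 L45–50)] -/
theorem contOneCocycles.continuous_apply_conj_mul_self (cd : ConjugationDatum K)
    (φ : contOneCocycles ρbar.toTopRep) :
    Continuous fun σ : absoluteGaloisGroup K => φ.1 (cd.conj σ * σ) :=
  φ.1.continuous.comp ((map_continuous cd.conj).mul continuous_id)

end Trivial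

/-! ## §2 «`c^± : G⁺ → T̄^±` is nontrivial»: an eigencocycle does not vanish at some `σ^τ σ` -/

namespace ResidualTau

variable {R : Type} [CommRing R] [Module R Nbar] {cd : ConjugationDatum K}
  {ρbar : DiscreteGaloisModule K Nbar}

/-- **The eigenspace argument of Lemma 1.6.2, one class, generic sign.**  Let `Λ ≤ Γ_K` be a normal
`τ`-stable subgroup acting trivially on `T̄` (Howard's `Γ_L`), `φ` a continuous cocycle which on
`Λ` satisfies `φ(g^τ) = L(φ(g))` for an `R`-linear `L` admitting a non-zero FIXED vector `v`
(`L = θ`, `v = x⁺`, for `c ∈ H¹(K,T̄)⁺`; `L = -θ`, `v = x⁻`, for `c ∈ H¹(K,T̄)⁻`), and `φ|_Λ ≠ 0`.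
If `T̄` has no proper non-zero `Γ_K`-stable `R`-submodule (H.1) and `2 ∈ R×`, then
`φ(σ^τ σ) ≠ 0` for some `σ ∈ Λ`.  (Otherwise `φ(g^τ) = -φ(g)` on `Λ`, so `L` acts by `-1` on the
`Γ_K`-stable span `R·φ(Λ) ≠ 0`, which is then all of `T̄` and contains `v`: `2v = 0`.)
[cite: Howard2004HeegnerKolyvagin, Lemma 1.6.2 proof (arXiv p. 11 L41–47)] -/
theorem exists_mem_apply_conj_mul_self_ne_zero (cd : ConjugationDatum K)
    (ρbar : DiscreteGaloisModule K Nbar) (hlin : ρbar.IsScalarLinear R)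
    (hirr : ∀ W : Submodule R Nbar,
      (∀ (σ : absoluteGaloisGroup K) (x : Nbar), x ∈ W → ρbar σ x ∈ W) → W = ⊥ ∨ W = ⊤)
    (htwo : IsUnit (2 : R)) (L : Nbar →ₗ[R] Nbar) {v : Nbar} (hv : v ≠ 0) (hLv : L v = v)
    {Λ : Subgroup (absoluteGaloisGroup K)} (hΛn : Λ.Normal) (hΛc : ∀ g ∈ Λ, cd.conj g ∈ Λ)
    (hΛt : ∀ g ∈ Λ, ∀ x : Nbar, ρbar g x = x) (φ : contOneCocycles ρbar.toTopRep)
    (hφ : ∀ g ∈ Λ, φ.1 (cd.conj g) = L (φ.1 g)) (hne : ∃ g ∈ Λ, φ.1 g ≠ 0) :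
    ∃ σ ∈ Λ, φ.1 (cd.conj σ * σ) ≠ 0 := by
  by_contra hcon
  push Not at hcon
  -- on `Λ`, `L (φ g) = -φ g`
  have hanti : ∀ g ∈ Λ, L (φ.1 g) = -φ.1 g := fun g hg => by
    have h := hcon g hg
    rw [contOneCocycles.apply_mul_of_apply_eq ρbar φ (hΛt _ (hΛc g hg)), hφ g hg] at h
    exact eq_neg_of_add_eq_zero_left h
  -- the `Γ_K`-stable span of `φ(Λ)`
  set W : Submodule R Nbar := Submodule.span R (φ.1 '' (Λ : Set (absoluteGaloisGroup K))) with hW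
  have hWstab : ∀ (σ : absoluteGaloisGroup K) (x : Nbar), x ∈ W → ρbar σ x ∈ W := by
    intro σ x hx
    let f : Nbar →ₗ[R] Nbar :=
      { toFun := fun y => ρbar σ y
        map_add' := fun a b => map_add _ a b
        map_smul' := fun r a => hlin σ r a }
    have hle : W.map f ≤ W := by
      rw [hW, Submodule.map_span, Submodule.span_le]
      rintro _ ⟨_, ⟨g, hg, rfl⟩, rfl⟩
      refine Submodule.subset_span ⟨σ * g * σ⁻¹, hΛn.conj_mem g hg σ, ?_⟩
      exact contOneCocycles.apply_conj_of_apply_eq ρbar φ (hΛt g hg) σ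
    exact hle (Submodule.mem_map_of_mem hx)
  have hWle : W ≤ LinearMap.ker (L + LinearMap.id) := by
    rw [hW, Submodule.span_le]
    rintro _ ⟨g, hg, rfl⟩
    simp only [SetLike.mem_coe, LinearMap.mem_ker, LinearMap.add_apply, LinearMap.id_apply,
      hanti g hg, neg_add_cancel]
  rcases hirr W hWstab with hbot | htop
  · obtain ⟨g, hg, hg0⟩ := hne
    have hmem : φ.1 g ∈ W := Submodule.subset_span ⟨g, hg, rfl⟩
    rw [hbot, Submodule.mem_bot] at hmem
    exact hg0 hmem
  · have hmem : v ∈ W := by rw [htop]; exact Submodule.mem_top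
    have h2 : L v + v = 0 := by simpa using hWle hmem
    rw [hLv, ← two_smul R] at h2
    obtain ⟨u, hu⟩ := htwo
    have h3 : u • v = 0 := by rw [Units.smul_def, hu]; exact h2
    exact hv (by rw [← inv_smul_smul u v, h3, smul_zero])

/-- **«`c⁺ : G⁺ → T̄⁺` is nontrivial»** (`L = θ`, fixed vector `x⁺` of H.5(a)): a `(+)`-eigencocycle
with `φ|_Λ ≠ 0` has `φ(σ^τ σ) ≠ 0` for some `σ ∈ Λ`.
[cite: Howard2004HeegnerKolyvagin, Lemma 1.6.2 proof (arXiv p. 11 L41–47)] -/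
theorem exists_mem_apply_conj_mul_self_ne_zero_of_theta_eq (A : ResidualTau (R := R) cd ρbar)
    (hlin : ρbar.IsScalarLinear R)
    (hirr : ∀ W : Submodule R Nbar,
      (∀ (σ : absoluteGaloisGroup K) (x : Nbar), x ∈ W → ρbar σ x ∈ W) → W = ⊥ ∨ W = ⊤)
    (h5a : H5a A) (htwo : IsUnit (2 : R))
    {Λ : Subgroup (absoluteGaloisGroup K)} (hΛn : Λ.Normal) (hΛc : ∀ g ∈ Λ, cd.conj g ∈ Λ)
    (hΛt : ∀ g ∈ Λ, ∀ x : Nbar, ρbar g x = x) (φ : contOneCocycles ρbar.toTopRep)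
    (hφ : ∀ g ∈ Λ, φ.1 (cd.conj g) = A.θ (φ.1 g)) (hne : ∃ g ∈ Λ, φ.1 g ≠ 0) :
    ∃ σ ∈ Λ, φ.1 (cd.conj σ * σ) ≠ 0 := by
  obtain ⟨xp, hxp, hθxp, -⟩ := h5a
  exact exists_mem_apply_conj_mul_self_ne_zero cd ρbar hlin hirr htwo A.θ hxp hθxp hΛn hΛc hΛt φ
    hφ hne

/-- **«`c⁻ : G⁺ → T̄⁻` is nontrivial»** (`L = -θ`, fixed vector `x⁻` of H.5(a)): a `(-)`-eigencocycle
with `φ|_Λ ≠ 0` has `φ(σ^τ σ) ≠ 0` for some `σ ∈ Λ`.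
[cite: Howard2004HeegnerKolyvagin, Lemma 1.6.2 proof (arXiv p. 11 L41–47)] -/
theorem exists_mem_apply_conj_mul_self_ne_zero_of_theta_eq_neg (A : ResidualTau (R := R) cd ρbar)
    (hlin : ρbar.IsScalarLinear R)
    (hirr : ∀ W : Submodule R Nbar,
      (∀ (σ : absoluteGaloisGroup K) (x : Nbar), x ∈ W → ρbar σ x ∈ W) → W = ⊥ ∨ W = ⊤)
    (h5a : H5a A) (htwo : IsUnit (2 : R))
    {Λ : Subgroup (absoluteGaloisGroup K)} (hΛn : Λ.Normal) (hΛc : ∀ g ∈ Λ, cd.conj g ∈ Λ)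
    (hΛt : ∀ g ∈ Λ, ∀ x : Nbar, ρbar g x = x) (φ : contOneCocycles ρbar.toTopRep)
    (hφ : ∀ g ∈ Λ, φ.1 (cd.conj g) = -A.θ (φ.1 g)) (hne : ∃ g ∈ Λ, φ.1 g ≠ 0) :
    ∃ σ ∈ Λ, φ.1 (cd.conj σ * σ) ≠ 0 := by
  obtain ⟨-, -, -, xm, hxm, hθxm, -⟩ := h5a
  refine exists_mem_apply_conj_mul_self_ne_zero cd ρbar hlin hirr htwo (-A.θ) hxm ?_ hΛn hΛc hΛt φ
    (fun g hg => by rw [hφ g hg, LinearMap.neg_apply]) hne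
  rw [LinearMap.neg_apply, hθxm, neg_neg]

/-! ## §3 «there is an `η = (τσ)² ∈ G⁺` with `c^±(η)` both nonzero» — with an open kernel -/

/-- **One class, with the open kernel**: under the hypotheses of
`exists_mem_apply_conj_mul_self_ne_zero` and `Λ` OPEN, there are `σ ∈ Λ` and an open subgroup
`U ≤ Λ` with `φ((uσ)^τ (uσ)) ≠ 0` for every `u ∈ U` (`U` = the kernel of the continuous
homomorphism `u ↦ φ(u^τ u)` on `Λ`).
[cite: Howard2004HeegnerKolyvagin, Lemma 1.6.2 proof (arXiv p. 11 L45–50)] -/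
theorem exists_isOpen_forall_apply_conj_mul_ne_zero_single (cd : ConjugationDatum K)
    (ρbar : DiscreteGaloisModule K Nbar) (hlin : ρbar.IsScalarLinear R)
    (hirr : ∀ W : Submodule R Nbar,
      (∀ (σ : absoluteGaloisGroup K) (x : Nbar), x ∈ W → ρbar σ x ∈ W) → W = ⊥ ∨ W = ⊤)
    (htwo : IsUnit (2 : R)) (L : Nbar →ₗ[R] Nbar) {v : Nbar} (hv : v ≠ 0) (hLv : L v = v)
    {Λ : Subgroup (absoluteGaloisGroup K)} (hΛo : IsOpen (Λ : Set (absoluteGaloisGroup K)))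
    (hΛn : Λ.Normal) (hΛc : ∀ g ∈ Λ, cd.conj g ∈ Λ)
    (hΛt : ∀ g ∈ Λ, ∀ x : Nbar, ρbar g x = x) (φ : contOneCocycles ρbar.toTopRep)
    (hφ : ∀ g ∈ Λ, φ.1 (cd.conj g) = L (φ.1 g)) (hne : ∃ g ∈ Λ, φ.1 g ≠ 0) :
    ∃ σ ∈ Λ, ∃ U : Subgroup (absoluteGaloisGroup K), IsOpen (U : Set (absoluteGaloisGroup K)) ∧
      U ≤ Λ ∧ ∀ u ∈ U, φ.1 (cd.conj (u * σ) * (u * σ)) ≠ 0 := by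
  obtain ⟨σ, hσ, hσ0⟩ :=
    exists_mem_apply_conj_mul_self_ne_zero cd ρbar hlin hirr htwo L hv hLv hΛn hΛc hΛt φ hφ hne
  let U : Subgroup (absoluteGaloisGroup K) :=
    { carrier := {u | u ∈ Λ ∧ φ.1 (cd.conj u * u) = 0}
      mul_mem' := by
        rintro a b ⟨ha, ha0⟩ ⟨hb, hb0⟩
        exact ⟨Λ.mul_mem ha hb, by
          rw [contOneCocycles.apply_conj_mul_self_mul ρbar cd φ hΛc hΛt ha hb, ha0, hb0, add_zero]⟩
      one_mem' := ⟨Λ.one_mem, contOneCocycles.apply_conj_one_mul_one ρbar cd φ⟩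
      inv_mem' := by
        rintro a ⟨ha, ha0⟩
        exact ⟨Λ.inv_mem ha, by
          rw [contOneCocycles.apply_conj_inv_mul_inv ρbar cd φ hΛc hΛt ha, ha0, neg_zero]⟩ }
  have hUo : IsOpen (U : Set (absoluteGaloisGroup K)) := by
    have : (U : Set (absoluteGaloisGroup K)) =
        (Λ : Set (absoluteGaloisGroup K)) ∩ (fun u => φ.1 (cd.conj u * u)) ⁻¹' {0} := rfl
    rw [this]
    exact hΛo.inter ((isOpen_discrete _).preimage
      (contOneCocycles.continuous_apply_conj_mul_self ρbar cd φ))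
  refine ⟨σ, hσ, U, hUo, fun u hu => hu.1, fun u hu => ?_⟩
  rw [contOneCocycles.apply_conj_mul_self_mul ρbar cd φ hΛc hΛt hu.1 hσ, hu.2, zero_add]
  exact hσ0

/-- **The eigenspace step of Lemma 1.6.2, both classes.**  `Λ ≤ Γ_K` open, normal, `τ`-stable,
acting trivially on `T̄`; `φ⁺`, `φ⁻` continuous cocycles with `φ⁺(g^τ) = θ(φ⁺ g)`,
`φ⁻(g^τ) = -θ(φ⁻ g)` on `Λ` and `φ^±|_Λ ≠ 0`; H.1 (no proper non-zero stable submodule), H.5(a),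
`2 ∈ R×`.  Then there are `σ ∈ Λ` and an open subgroup `U ≤ Λ` such that
`φ⁺((uσ)^τ(uσ)) ≠ 0` and `φ⁻((uσ)^τ(uσ)) ≠ 0` for every `u ∈ U` — «the kernels of the maps
`c^± : G⁺ → T̄^±` have codimension `≥ 1`, and so there is an `η ∈ G⁺` for which `c^±(η)` are both
nonzero, and we may choose some `σ ∈ G` such that `η = (τσ)²`» (a group is not the union of two
proper subgroups; `U` = the common kernel of `u ↦ φ^±(u^τ u)` on `Λ`).
[cite: Howard2004HeegnerKolyvagin, Lemma 1.6.2 proof (arXiv p. 11 L41–47)] -/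
theorem exists_isOpen_forall_apply_conj_mul_ne_zero (A : ResidualTau (R := R) cd ρbar)
    (hlin : ρbar.IsScalarLinear R)
    (hirr : ∀ W : Submodule R Nbar,
      (∀ (σ : absoluteGaloisGroup K) (x : Nbar), x ∈ W → ρbar σ x ∈ W) → W = ⊥ ∨ W = ⊤)
    (h5a : H5a A) (htwo : IsUnit (2 : R))
    {Λ : Subgroup (absoluteGaloisGroup K)} (hΛo : IsOpen (Λ : Set (absoluteGaloisGroup K)))
    (hΛn : Λ.Normal) (hΛc : ∀ g ∈ Λ, cd.conj g ∈ Λ) (hΛt : ∀ g ∈ Λ, ∀ x : Nbar, ρbar g x = x)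
    (φp φm : contOneCocycles ρbar.toTopRep)
    (hφp : ∀ g ∈ Λ, φp.1 (cd.conj g) = A.θ (φp.1 g))
    (hφm : ∀ g ∈ Λ, φm.1 (cd.conj g) = -A.θ (φm.1 g))
    (hnep : ∃ g ∈ Λ, φp.1 g ≠ 0) (hnem : ∃ g ∈ Λ, φm.1 g ≠ 0) :
    ∃ σ ∈ Λ, ∃ U : Subgroup (absoluteGaloisGroup K), IsOpen (U : Set (absoluteGaloisGroup K)) ∧
      U ≤ Λ ∧ ∀ u ∈ U, φp.1 (cd.conj (u * σ) * (u * σ)) ≠ 0 ∧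
        φm.1 (cd.conj (u * σ) * (u * σ)) ≠ 0 := by
  obtain ⟨g₁, hg₁, h₁⟩ := exists_mem_apply_conj_mul_self_ne_zero_of_theta_eq A hlin hirr h5a htwo
    hΛn hΛc hΛt φp hφp hnep
  obtain ⟨g₂, hg₂, h₂⟩ := exists_mem_apply_conj_mul_self_ne_zero_of_theta_eq_neg A hlin hirr h5a
    htwo hΛn hΛc hΛt φm hφm hnem
  -- a `σ ∈ Λ` outside both kernels
  obtain ⟨σ, hσ, hσp, hσm⟩ : ∃ σ ∈ Λ, φp.1 (cd.conj σ * σ) ≠ 0 ∧ φm.1 (cd.conj σ * σ) ≠ 0 := by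
    by_cases hm₁ : φm.1 (cd.conj g₁ * g₁) ≠ 0
    · exact ⟨g₁, hg₁, h₁, hm₁⟩
    by_cases hp₂ : φp.1 (cd.conj g₂ * g₂) ≠ 0
    · exact ⟨g₂, hg₂, hp₂, h₂⟩
    push Not at hm₁ hp₂
    refine ⟨g₁ * g₂, Λ.mul_mem hg₁ hg₂, ?_, ?_⟩
    · rw [contOneCocycles.apply_conj_mul_self_mul ρbar cd φp hΛc hΛt hg₁ hg₂, hp₂, add_zero]
      exact h₁
    · rw [contOneCocycles.apply_conj_mul_self_mul ρbar cd φm hΛc hΛt hg₁ hg₂, hm₁, zero_add]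
      exact h₂
  let U : Subgroup (absoluteGaloisGroup K) :=
    { carrier := {u | u ∈ Λ ∧ φp.1 (cd.conj u * u) = 0 ∧ φm.1 (cd.conj u * u) = 0}
      mul_mem' := by
        rintro a b ⟨ha, ha0, ha0'⟩ ⟨hb, hb0, hb0'⟩
        exact ⟨Λ.mul_mem ha hb, by
          rw [contOneCocycles.apply_conj_mul_self_mul ρbar cd φp hΛc hΛt ha hb, ha0, hb0, add_zero],
          by rw [contOneCocycles.apply_conj_mul_self_mul ρbar cd φm hΛc hΛt ha hb, ha0', hb0',
            add_zero]⟩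
      one_mem' := ⟨Λ.one_mem, contOneCocycles.apply_conj_one_mul_one ρbar cd φp,
        contOneCocycles.apply_conj_one_mul_one ρbar cd φm⟩
      inv_mem' := by
        rintro a ⟨ha, ha0, ha0'⟩
        exact ⟨Λ.inv_mem ha, by
          rw [contOneCocycles.apply_conj_inv_mul_inv ρbar cd φp hΛc hΛt ha, ha0, neg_zero], by
          rw [contOneCocycles.apply_conj_inv_mul_inv ρbar cd φm hΛc hΛt ha, ha0', neg_zero]⟩ }
  have hUo : IsOpen (U : Set (absoluteGaloisGroup K)) := by
    have : (U : Set (absoluteGaloisGroup K)) =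
        (Λ : Set (absoluteGaloisGroup K)) ∩ ((fun u => φp.1 (cd.conj u * u)) ⁻¹' {0} ∩
          (fun u => φm.1 (cd.conj u * u)) ⁻¹' {0}) := by
      ext u; simp only [Set.mem_inter_iff, Set.mem_preimage, Set.mem_singleton_iff]; rfl
    rw [this]
    exact hΛo.inter (((isOpen_discrete _).preimage
      (contOneCocycles.continuous_apply_conj_mul_self ρbar cd φp)).inter
        ((isOpen_discrete _).preimage (contOneCocycles.continuous_apply_conj_mul_self ρbar cd φm)))
  refine ⟨σ, hσ, U, hUo, fun u hu => hu.1, fun u hu => ⟨?_, ?_⟩⟩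
  · rw [contOneCocycles.apply_conj_mul_self_mul ρbar cd φp hΛc hΛt hu.1 hσ, hu.2.1, zero_add]
    exact hσp
  · rw [contOneCocycles.apply_conj_mul_self_mul ρbar cd φm hΛc hΛt hu.1 hσ, hu.2.2, zero_add]
    exact hσm

end ResidualTau

end Literature.NumberTheory.GaloisCohomology.Howard2004

end
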